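import Literature.MathematicalPhysics.QuantumFieldTheory.Balaban1983to89.B10

/-!
# `Summit.QuantumFields.Balaban3D.Proofs.FirstStepThresholds` — [Balaban1985UV3] Sect. A «for g₀ sufficiently small», EXPORTED AS
# ONE CLOSED CONSTANT (ruling R-EPS0′ / R-CONST: every proving seat exports its coupling threshold; p3 takes γ₀ = min of them and
# exhibits ε₀(g) = (min γ₀ 1)²/g²) — lane `pub-balaban3d`, seat p4 (the Sect. A seat: thresholds of (12), (13) [Lemma 1 of [6] and
# the enlargement], (16))

HONEST FRAMING (lane PLAN.md §0, binding): see `…Proofs.SectAFirstStep`.  Print fixes NO numbers for «sufficiently small»; the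
constant below is the lane's CHOICE making the four first-step smallness clauses hold simultaneously, each traced to its page and to
the LQB theorem whose hypothesis it feeds.  Real arithmetic only.

WHAT IS PRINTED (all «g₀ sufficiently small» of Sect. A, pp. 258–260, renders p004–p006):
* (12) p. 258 L34–p. 259 L1: «For g₀ sufficiently small 2L²g₀p(g₀) ≤ a₁, where a₁ is the constant in Theorem 1 [7]»;
* (13) p. 259 L8–12: «U₁, U′U₁ satisfy the assumptions of Lemma 1 [6] with α₀ = 2L²B₃g₀p(g₀), α₁ = 0, and the lemma yields the
  bound |V′ − 1| < 8·3²L²B₃g₀p(g₀) for g₀ sufficiently small. We enlarge the region of integration to all configurations V′ = e^{iA′}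
  satisfying |A′| < 16·3²L²B₃g₀p(g₀)» — LQB: Lemma 1 of [6] needs `2L²B₃·ε ≤ 1/(6(d+1))` (`B10Eq13RegularityClaims`, model note M4,
  `claim259_d3`), the enlargement needs the V′-radius `8·3²L²B₃g₀p(g₀) ≤ 1/4` (`B10Eq13Enlargement.region_subset_enlarged_selfAdjoint`,
  `c ≤ 1/4`; `≤ 1/2` for `region_subset_enlarged`);
* (16) p. 259 L33–37 with (14)–(15): the chart constraint needs `‖Q(A′)‖ < 1` on `|A′| < 16·3²L²B₃g₀p(g₀)` (this seat's
  `SectAEq16.eq16_of_eq14`, side condition (ii)), and [4] (131)/(161) give `‖Q(U₀, B)‖ ≤ 2L·sup|B|` (LQB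
  `B7Eq123General.norm_mlog_dbavgCovIter_le`), so `2L·16·3²L²B₃g₀p(g₀) < 1` suffices.

WHAT THIS FILE PROVIDES (no `sorry`, axioms standard): the σ-level threshold `sigmaA L B₃ a₁ := min (a₁/(2L²)) (1/(576·L³·B₃))` for
the product `t = g₀p(g₀)` (p. 257 (7): ε₁ = g₀p(g₀)), `sigmaA_pos`, and the four consequences of `t ≤ sigmaA`: `eq12_smallness`
(`2L²t ≤ a₁`), `lemma1_smallness` (`2L²B₃t ≤ 1/24 = 1/(6(d+1))` at d = 3), `enlargement_smallness` (`8·3²L²B₃t ≤ 1/4`), `eq16_smallness`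
(`2L·(16·3²L²B₃t) ≤ 1/2`).  The passage from `t = g·p(g) ≤ σ` to a coupling window `0 < g ≤ γ(σ)` is p2's `Thresholds.gammaOf_spec`
(γ(σ) = min 1 (σ/(b₀Q₀(p₀)))²); this seat's export to p3's γ₀ is `γ_A := gammaOf b₀ p₀ (sigmaA L B₃ a₁)`.
-/

namespace Summit.QuantumFields.Balaban3D.Proofs.FirstStepThresholds

/-- THE FIRST-STEP SMALLNESS THRESHOLD for `t = g₀p(g₀)`: `σ_A = min (a₁/(2L²)) (1/(576 L³ B₃))` — the first member is (12)'s
«2L²g₀p(g₀) ≤ a₁» (p. 259 L1), the second makes `2L·16·3²L²B₃·t ≤ ½` ((16) via [4] (161)) and a fortiori Lemma 1's and the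
enlargement's clauses of (13) (p. 259 L8–12).  A lane CHOICE (print: «sufficiently small»). [cite: Balaban1985UV3, (12)–(13) pp.258–259] -/
noncomputable def sigmaA (L : ℕ) (B₃ a₁ : ℝ) : ℝ := min (a₁ / (2 * (L : ℝ) ^ 2)) (1 / (576 * (L : ℝ) ^ 3 * B₃))

variable {L : ℕ} {B₃ a₁ t : ℝ}

/-- `σ_A > 0` for `L ≥ 1`, `B₃ > 0`, `a₁ > 0`. [folklore] -/
theorem sigmaA_pos (hL : 1 ≤ L) (hB : 0 < B₃) (ha : 0 < a₁) : 0 < sigmaA L B₃ a₁ := by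
  have hLr : (0 : ℝ) < L := by exact_mod_cast (show 0 < L by omega)
  unfold sigmaA
  exact lt_min (by positivity) (by positivity)

/-- **(12)** p. 258 L34–p. 259 L1 «For g₀ sufficiently small 2L²g₀p(g₀) ≤ a₁»: holds once `g₀p(g₀) ≤ σ_A`. [cite: Balaban1985UV3, (12) p.258] -/
theorem eq12_smallness (hL : 1 ≤ L) (ht : t ≤ sigmaA L B₃ a₁) : 2 * (L : ℝ) ^ 2 * t ≤ a₁ := by
  have hLr : (0 : ℝ) < L := by exact_mod_cast (show 0 < L by omega)
  have h1 : t ≤ a₁ / (2 * (L : ℝ) ^ 2) := ht.trans (min_le_left _ _)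
  have hL2 : 0 < 2 * (L : ℝ) ^ 2 := by positivity
  calc 2 * (L : ℝ) ^ 2 * t ≤ 2 * (L : ℝ) ^ 2 * (a₁ / (2 * (L : ℝ) ^ 2)) := mul_le_mul_of_nonneg_left h1 hL2.le
    _ = a₁ := by field_simp

/-- The common core of the (13)/(16) clauses: `L²B₃·t ≤ 1/(576 L)` once `t ≤ σ_A` (`B₃ > 0`, `L ≥ 1`). [folklore] -/
theorem lsq_B3_mul_le (hL : 1 ≤ L) (hB : 0 < B₃) (ht : t ≤ sigmaA L B₃ a₁) :
    (L : ℝ) ^ 2 * B₃ * t ≤ 1 / (576 * (L : ℝ)) := by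
  have hLr : (0 : ℝ) < L := by exact_mod_cast (show 0 < L by omega)
  have h1 : t ≤ 1 / (576 * (L : ℝ) ^ 3 * B₃) := ht.trans (min_le_right _ _)
  have hpos : 0 < (L : ℝ) ^ 2 * B₃ := by positivity
  calc (L : ℝ) ^ 2 * B₃ * t ≤ (L : ℝ) ^ 2 * B₃ * (1 / (576 * (L : ℝ) ^ 3 * B₃)) := mul_le_mul_of_nonneg_left h1 hpos.le
    _ = 1 / (576 * (L : ℝ)) := by field_simp

/-- **(13), Lemma 1 of [6]** (p. 259 L8–11, «α₀ = 2L²B₃g₀p(g₀), α₁ = 0 … for g₀ sufficiently small»): LQB's threshold for Lemma 1,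
`2L²B₃·ε ≤ 1/(6(d+1)) = 1/24` at d = 3 (`B10Eq13RegularityClaims`, note M4), holds once `g₀p(g₀) ≤ σ_A`. [cite: Balaban1985UV3, (13) p.259] -/
theorem lemma1_smallness (hL : 1 ≤ L) (hB : 0 < B₃) (ht : t ≤ sigmaA L B₃ a₁) : 2 * (L : ℝ) ^ 2 * B₃ * t ≤ 1 / 24 := by
  have hLr : (1 : ℝ) ≤ L := by exact_mod_cast hL
  have h := lsq_B3_mul_le hL hB ht
  have h2 : 1 / (576 * (L : ℝ)) ≤ 1 / 576 := by
    apply div_le_div_of_nonneg_left zero_le_one (by norm_num) (by nlinarith)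
  nlinarith

/-- **(13), the enlargement** (p. 259 L11–12 «We enlarge the region of integration to all configurations V′ = e^{iA′} satisfying
|A′| < 16·3²L²B₃g₀p(g₀)»): LQB's radius condition `8·3²L²B₃g₀p(g₀) ≤ 1/4` (`B10Eq13Enlargement.region_subset_enlarged_selfAdjoint`,
`c ≤ 1/4`; implies the `c ≤ 1/2` of `region_subset_enlarged`) holds once `g₀p(g₀) ≤ σ_A`. [cite: Balaban1985UV3, (13) p.259] -/
theorem enlargement_smallness (hL : 1 ≤ L) (hB : 0 < B₃) (ht : t ≤ sigmaA L B₃ a₁) :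
    8 * 3 ^ 2 * (L : ℝ) ^ 2 * B₃ * t ≤ 1 / 4 := by
  have hLr : (1 : ℝ) ≤ L := by exact_mod_cast hL
  have h := lsq_B3_mul_le hL hB ht
  have h2 : 1 / (576 * (L : ℝ)) ≤ 1 / 576 := by
    apply div_le_div_of_nonneg_left zero_le_one (by norm_num) (by nlinarith)
  nlinarith

/-- **(16) side condition (ii)** (p. 259 L33–37; this seat's `SectAEq16.eq16_of_eq14`): with [4] (161) `‖Q(U₀, B)‖ ≤ 2L·sup|B|`
(LQB `B7Eq123General.norm_mlog_dbavgCovIter_le`) on the fluctuation domain `|A′| < r = 16·3²L²B₃g₀p(g₀)`, `‖Q(A′)‖ ≤ 2L·r ≤ ½ < 1`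
once `g₀p(g₀) ≤ σ_A`. [cite: Balaban1985UV3, (16) p.259] -/
theorem eq16_smallness (hL : 1 ≤ L) (hB : 0 < B₃) (ht : t ≤ sigmaA L B₃ a₁) :
    2 * (L : ℝ) * (16 * 3 ^ 2 * (L : ℝ) ^ 2 * B₃ * t) ≤ 1 / 2 := by
  have hLr : (0 : ℝ) < L := by exact_mod_cast (show 0 < L by omega)
  have h := lsq_B3_mul_le hL hB ht
  calc 2 * (L : ℝ) * (16 * 3 ^ 2 * (L : ℝ) ^ 2 * B₃ * t) = 288 * (L : ℝ) * ((L : ℝ) ^ 2 * B₃ * t) := by ring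
    _ ≤ 288 * (L : ℝ) * (1 / (576 * (L : ℝ))) := mul_le_mul_of_nonneg_left h (by positivity)
    _ = 1 / 2 := by field_simp; norm_num

end Summit.QuantumFields.Balaban3D.Proofs.FirstStepThresholds
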